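import Summits.QuantumFields.GaugeBoot.ClassBRPClosure
import Summits.QuantumFields.GaugeBoot.ClassBLimitLinkGeometry
import Literature.MathematicalPhysics.QuantumFieldTheory.ConstructiveQFTWave0SiteRPProofs
import Summits.QuantumFields.YangMills.Theorems.SoloBlindExpObservable
import HarnessLib

/-!
# Site reflections: the odd torus and lifting site-half observables (gauge-boot, Class-B brick)

HONEST FRAMING (cell `pub-gaugeboot`, page 1 of every file): the venture produces certified bounds
on lattice expectations at stated coupling, gauge group, dimension and torus size; NOT a mass gap,
NOT a continuum limit, NOT a string tension; NOT Yang–Mills-summit-bearing (barriers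
`FixedCouplingUltralocality`, `PerturbativeInvisibility`).

Torus-side preliminaries for the site reflection positivity of limit points (`ClassBLimitSiteRP.lean`):

* `negReflect_eq_conj_timeReflect` — on the ODD torus `L = 2n+1` the site reflection `t ↦ -t`
  (`GaugeConfig.negReflect`) is conjugate by the translation `t ↦ t + n` to Wave 0's `t ↦ 1 - t`
  (`GaugeConfig.timeReflect`); hence `torus_siteRP_nonneg_odd`: site RP on the odd torus
  (`β ≥ 0`), transported from `wilsonExpectation_oddReflectionPositive` by translation invariance
  and by passing to the mirror image of the observable;
* `dependsOn_toTorusObservable_sitePos` (even torus: a cylinder observable supported on links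
  with `0 ≤ x_0 ≤ m < L/2` lifts into Wave 0's closed site half `sitePosEdges ∪ sharedEdges`) and
  `dependsOn_mirror_toTorusObservable_oPos` (odd torus: the mirror image of the translated lift
  lives in `oPosEdges ∪ oSharedEdges`).

References: K. Osterwalder, E. Seiler, Ann. Phys. 110 (1978) 440, §2; J. Fröhlich, R. Israel,
E. H. Lieb, B. Simon, Commun. Math. Phys. 62 (1978) 1, Thm. 2.1; C. Borgs, E. Seiler, Commun.
Math. Phys. 91 (1983) 329, §II.2.
-/

noncomputable section

open MeasureTheory Filter Topology
open scoped ComplexOrder ComplexConjugate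
open Literature.Probability.LatticeModels (Torus.proj)
open Literature.MathematicalPhysics.QuantumLattice
open Literature.MathematicalPhysics.QuantumFieldTheory (GaugeConfig Edge Site wilsonExpectation
  wilsonMeasure isProbabilityMeasure_wilsonMeasure measurable_torusLift
  wilsonExpectation_siteReflectionPositive wilsonExpectation_oddReflectionPositive
  wilsonExpectation_comp_torusConfigShift)
open Literature.MathematicalPhysics.QuantumFieldTheory.TorusTranslation (torusConfigShift
  torusConfigShift_apply)

namespace Summit.QuantumFields.GaugeBoot

variable {d N : ℕ} [NeZero d] {G : Type*} [Group G] [TopologicalSpace G] [IsTopologicalGroup G]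
  [CompactSpace G] [MeasurableSpace G] [BorelSpace G]
variable (ρ : G →* Matrix (Fin N) (Fin N) ℂ)

/-! ## The odd torus: the site reflection is conjugate to Wave 0's reflection -/

section OddTorus

variable {L : ℕ} [NeZero L]

omit [TopologicalSpace G] [IsTopologicalGroup G] [CompactSpace G] [BorelSpace G] [NeZero L] in
/-- **On the odd torus `L = 2n + 1` the site reflection `t ↦ -t` is conjugate to Wave 0's
reflection `t ↦ 1 - t` by the translation `t ↦ t + n`**:
`negReflect = τ_{n e₀} ∘ timeReflect ∘ τ_{-n e₀}` (`2n + 1 = 0` in `ℤ/L`). -/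
theorem negReflect_eq_conj_timeReflect (hL : Odd L) (U : GaugeConfig d L G) :
    U.negReflect = torusConfigShift (Pi.single 0 (((L / 2 : ℕ)) : ZMod L))
      ((torusConfigShift (-Pi.single 0 (((L / 2 : ℕ)) : ZMod L)) U).timeReflect) := by
  set n : ℕ := L / 2 with hn
  have hLn : (n : ZMod L) + (n : ZMod L) + 1 = 0 := by
    obtain ⟨r, hr⟩ := hL
    have h2 : n = r := by omega
    rw [h2]
    have : ((2 * r + 1 : ℕ) : ZMod L) = 0 := by rw [← hr]; exact ZMod.natCast_self L
    push_cast at this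
    linear_combination this
  funext e
  obtain ⟨x, k⟩ := e
  -- the two site identities
  by_cases hk : k = 0
  · subst hk
    simp only [Literature.MathematicalPhysics.QuantumFieldTheory.GaugeConfig.negReflect,
      Literature.MathematicalPhysics.QuantumFieldTheory.GaugeConfig.timeReflect,
      Literature.MathematicalPhysics.QuantumFieldTheory.Site.negReflect,
      Literature.MathematicalPhysics.QuantumFieldTheory.Site.timeReflect,
      Literature.MathematicalPhysics.QuantumFieldTheory.Site.shift, torusConfigShift_apply,
      ↓reduceIte]
    refine congrArg (fun s : Site d L => (U (s, 0))⁻¹) ?_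
    funext m
    by_cases hm : m = 0
    · subst hm
      simp only [Function.update_self, Pi.sub_apply, Pi.add_apply, Pi.neg_apply, Pi.single_eq_same]
      linear_combination -hLn
    · simp [hm]
  · simp only [Literature.MathematicalPhysics.QuantumFieldTheory.GaugeConfig.negReflect,
      Literature.MathematicalPhysics.QuantumFieldTheory.GaugeConfig.timeReflect,
      Literature.MathematicalPhysics.QuantumFieldTheory.Site.negReflect,
      Literature.MathematicalPhysics.QuantumFieldTheory.Site.timeReflect, torusConfigShift_apply,
      hk, ↓reduceIte]
    refine congrArg (fun s : Site d L => U (s, k)) ?_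
    funext m
    by_cases hm : m = 0
    · subst hm
      simp only [Function.update_self, Pi.sub_apply, Pi.neg_apply, Pi.single_eq_same]
      linear_combination -hLn
    · simp [hm]

/-- **Site RP on the odd torus** (`L` odd, `L ≥ 3`, `β ≥ 0`): `⟨conj F(negReflect U) · F(U)⟩ ≥ 0`
whenever the mirror image of the translated observable, `V ↦ F(τ_{n e₀} (timeReflect V))`,
depends only on Wave 0's odd positive half — transported from `wilsonExpectation_oddReflectionPositive`
by the conjugation `negReflect_eq_conj_timeReflect`, translation invariance, and complex
conjugation of the pairing. -/
theorem torus_siteRP_nonneg_odd (hL : Odd L) (hL3 : 3 ≤ L) (hρ : Continuous ρ) {β : ℝ}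
    (hβ : 0 ≤ β) (F : GaugeConfig d L G → ℂ) (hF : Measurable F) (hFb : ∃ C : ℝ, ∀ U, ‖F U‖ ≤ C)
    (hdep : DependsOn (fun V : GaugeConfig d L G =>
        F (torusConfigShift (Pi.single 0 (((L / 2 : ℕ)) : ZMod L)) V.timeReflect))
      ((Literature.MathematicalPhysics.QuantumFieldTheory.WilsonOddRP.oPosEdges ∪
        Literature.MathematicalPhysics.QuantumFieldTheory.WilsonOddRP.oSharedEdges :
          Finset (Edge d L)) : Set (Edge d L))) :
    0 ≤ wilsonExpectation ρ β fun U : GaugeConfig d L G => conj (F U.negReflect) * F U := by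
  have hΘm : Measurable (Literature.MathematicalPhysics.QuantumFieldTheory.GaugeConfig.timeReflect :
      GaugeConfig d L G → GaugeConfig d L G) :=
    Literature.MathematicalPhysics.QuantumFieldTheory.WilsonRP.measurable_timeReflect
  have hG'm : Measurable fun V : GaugeConfig d L G =>
      F (torusConfigShift (Pi.single 0 (((L / 2 : ℕ)) : ZMod L)) V.timeReflect) :=
    (hF.comp (torusConfigShift _).measurable).comp hΘm
  have hG'b : ∃ C : ℝ, ∀ V : GaugeConfig d L G,
      ‖F (torusConfigShift (Pi.single 0 (((L / 2 : ℕ)) : ZMod L)) V.timeReflect)‖ ≤ C := by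
    obtain ⟨C, hC⟩ := hFb; exact ⟨C, fun V => hC _⟩
  -- Step 1: conjugation and translation invariance
  have h1 : wilsonExpectation ρ β (fun U : GaugeConfig d L G => conj (F U.negReflect) * F U) =
      wilsonExpectation ρ β (fun V : GaugeConfig d L G =>
        conj (F (torusConfigShift (Pi.single 0 (((L / 2 : ℕ)) : ZMod L)) V.timeReflect)) *
          F (torusConfigShift (Pi.single 0 (((L / 2 : ℕ)) : ZMod L)) V)) := by
    have heq : (fun U : GaugeConfig d L G => conj (F U.negReflect) * F U) =
        (fun V : GaugeConfig d L G =>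
          conj (F (torusConfigShift (Pi.single 0 (((L / 2 : ℕ)) : ZMod L)) V.timeReflect)) *
            F (torusConfigShift (Pi.single 0 (((L / 2 : ℕ)) : ZMod L)) V)) ∘
          torusConfigShift (-Pi.single 0 (((L / 2 : ℕ)) : ZMod L)) := by
      funext U
      rw [Function.comp_apply, negReflect_eq_conj_timeReflect hL U]
      congr 2
      funext e
      simp only [torusConfigShift_apply, sub_neg_eq_add, sub_add_cancel]
    rw [heq, wilsonExpectation_comp_torusConfigShift ρ β]
  -- Step 2: the pairing is the conjugate of the pairing of the mirror image
  have h2 : wilsonExpectation ρ β (fun V : GaugeConfig d L G =>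
        conj (F (torusConfigShift (Pi.single 0 (((L / 2 : ℕ)) : ZMod L)) V.timeReflect)) *
          F (torusConfigShift (Pi.single 0 (((L / 2 : ℕ)) : ZMod L)) V)) =
      conj (wilsonExpectation ρ β (fun V : GaugeConfig d L G =>
        conj (F (torusConfigShift (Pi.single 0 (((L / 2 : ℕ)) : ZMod L)) V.timeReflect.timeReflect)) *
          F (torusConfigShift (Pi.single 0 (((L / 2 : ℕ)) : ZMod L)) V.timeReflect))) := by
    simp only [wilsonExpectation]
    rw [← integral_conj]
    congr 1
    funext V
    simp only [Summit.QuantumFields.YangMills.Theorems.SoloBlind.timeReflect_timeReflect_config, map_mul,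
      Complex.conj_conj, mul_comm]
  -- Step 3: the odd-torus theorem for the mirror image
  have h3 := wilsonExpectation_oddReflectionPositive ρ hL hL3 hρ hβ _ hG'm hG'b hdep
  rw [h1, h2]
  obtain ⟨hre, him⟩ := Complex.nonneg_iff.1 h3
  exact Complex.nonneg_iff.2 ⟨by rwa [Complex.conj_re], by rw [Complex.conj_im, ← him, neg_zero]⟩

end OddTorus

/-! ## Lifting a site-half observable to the torus -/

section Support

variable {L : ℕ} [NeZero L]

omit [Group G] [TopologicalSpace G] [IsTopologicalGroup G] [CompactSpace G] [MeasurableSpace G]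
  [BorelSpace G] in
/-- Even torus: a cylinder observable supported on links with `0 ≤ x_0 ≤ m`, `m < L/2`, lifts to an
observable of the closed site half `0 ≤ t ≤ L/2` (`sitePosEdges ∪ sharedEdges`). -/
theorem dependsOn_toTorusObservable_sitePos {α : Type*} {F : LGConfig d G → α}
    {T : Finset (ZdEdge d)} (hF : IsCylinder F T) {m : ℕ} (hT0 : ∀ e ∈ T, 0 ≤ e.1 0)
    (hTm : ∀ e ∈ T, e.1 0 ≤ m) (hmL : m + 1 ≤ L / 2) :
    DependsOn (toTorusObservable L F)
      ((Literature.MathematicalPhysics.QuantumFieldTheory.WilsonSiteRP.sitePosEdges ∪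
        Literature.MathematicalPhysics.QuantumFieldTheory.WilsonSiteRP.sharedEdges :
          Finset (Edge d L)) : Set (Edge d L)) := by
  intro U V hUV
  apply hF
  intro e he
  have he' := Finset.mem_coe.1 he
  have h0 := hT0 e he'
  have hm := hTm e he'
  have hL2 : (L / 2 : ℕ) ≤ L := Nat.div_le_self L 2
  have hv := val_torusProj_zero (d := d) (L := L) (x := e.1) h0 (by omega)
  simp only [torusLift, Function.comp_apply, torusEdge]
  refine hUV _ ?_
  rw [Finset.coe_union, Set.mem_union, Finset.mem_coe, Finset.mem_coe,
    Literature.MathematicalPhysics.QuantumFieldTheory.WilsonSiteRP.mem_sitePosEdges,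
    Literature.MathematicalPhysics.QuantumFieldTheory.WilsonSiteRP.mem_sharedEdges,
    Literature.MathematicalPhysics.QuantumFieldTheory.WilsonSiteRP.IsSitePosEdge,
    Literature.MathematicalPhysics.QuantumFieldTheory.WilsonSiteRP.IsSharedEdge]
  have hlt : ((Torus.proj L e.1) 0).val < L / 2 := by
    have : (((Torus.proj L e.1) 0).val : ℤ) < (L / 2 : ℕ) := by rw [hv]; omega
    exact_mod_cast this
  by_cases hk : e.2 = 0
  · left; rw [if_pos hk]; exact hlt
  · by_cases hx0 : e.1 0 = 0
    · right
      refine ⟨hk, Or.inl ?_⟩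
      have : (((Torus.proj L e.1) 0).val : ℤ) = 0 := by rw [hv, hx0]
      exact_mod_cast this
    · left
      rw [if_neg hk]
      refine ⟨?_, hlt⟩
      have : (1 : ℤ) ≤ ((Torus.proj L e.1) 0).val := by rw [hv]; omega
      exact_mod_cast this

omit [Group G] [TopologicalSpace G] [IsTopologicalGroup G] [CompactSpace G] [MeasurableSpace G]
  [BorelSpace G] in
/-- The value of a `ℤ/L` coordinate which is the cast of an integer in `[0, L)`. -/
theorem val_cast_of_nonneg_of_lt {a : ℤ} (h0 : 0 ≤ a) (hL : a < L) : (((a : ZMod L)).val : ℤ) = a := by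
  rw [ZMod.val_intCast, Int.emod_eq_of_lt h0 hL]

omit [TopologicalSpace G] [IsTopologicalGroup G] [CompactSpace G] [BorelSpace G] in
/-- Odd torus: for a cylinder observable supported on links with `0 ≤ x_0 ≤ m`, `m + 1 ≤ L/2`, the
mirror image of the translated lift (the observable of `torus_siteRP_nonneg_odd`) depends only on
Wave 0's odd positive half `oPosEdges ∪ oSharedEdges`. -/
theorem dependsOn_mirror_toTorusObservable_oPos (hL : Odd L) {F : LGConfig d G → ℂ}
    {T : Finset (ZdEdge d)} (hF : IsCylinder F T) {m : ℕ} (hT0 : ∀ e ∈ T, 0 ≤ e.1 0)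
    (hTm : ∀ e ∈ T, e.1 0 ≤ m) (hmL : m + 1 ≤ L / 2) :
    DependsOn (fun V : GaugeConfig d L G => toTorusObservable L F
        (torusConfigShift (Pi.single 0 (((L / 2 : ℕ)) : ZMod L)) V.timeReflect))
      ((Literature.MathematicalPhysics.QuantumFieldTheory.WilsonOddRP.oPosEdges ∪
        Literature.MathematicalPhysics.QuantumFieldTheory.WilsonOddRP.oSharedEdges :
          Finset (Edge d L)) : Set (Edge d L)) := by
  intro U V hUV
  simp only [toTorusObservable, Function.comp_apply]
  apply hF
  intro e he
  have he' := Finset.mem_coe.1 he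
  have h0 := hT0 e he'
  have hm := hTm e he'
  obtain ⟨r, hr⟩ := hL
  set n : ℕ := L / 2 with hn
  have hnr : n = r := by omega
  have hL2 : n ≤ L := Nat.div_le_self L 2
  have h2L : 2 * n ≤ L := Nat.mul_div_le L 2
  simp only [torusLift, Function.comp_apply, torusEdge, torusConfigShift_apply,
    Literature.MathematicalPhysics.QuantumFieldTheory.GaugeConfig.timeReflect]
  -- the reflected coordinates, as casts of integers
  have hsp : Literature.MathematicalPhysics.QuantumFieldTheory.Site.timeReflect
      (Torus.proj L e.1 - Pi.single 0 (n : ZMod L)) 0 = (((1 - e.1 0 + n : ℤ)) : ZMod L) := by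
    simp only [Literature.MathematicalPhysics.QuantumFieldTheory.Site.timeReflect, Torus.proj,
      Function.update_self, Pi.sub_apply, Pi.single_eq_same]
    push_cast
    ring
  have htm : Literature.MathematicalPhysics.QuantumFieldTheory.Site.timeReflect
      (Literature.MathematicalPhysics.QuantumFieldTheory.Site.shift
        (Torus.proj L e.1 - Pi.single 0 (n : ZMod L)) 0) 0 = (((-e.1 0 + n : ℤ)) : ZMod L) := by
    simp only [Literature.MathematicalPhysics.QuantumFieldTheory.Site.timeReflect,
      Literature.MathematicalPhysics.QuantumFieldTheory.Site.shift, Torus.proj, Function.update_self,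
      Pi.sub_apply, Pi.add_apply, Pi.single_eq_same]
    push_cast
    ring
  by_cases hk : e.2 = 0
  · rw [if_pos hk, if_pos hk]
    congr 1
    refine hUV _ ?_
    rw [Finset.coe_union, Set.mem_union, Finset.mem_coe,
      Literature.MathematicalPhysics.QuantumFieldTheory.WilsonOddRP.mem_oPosEdges,
      Literature.MathematicalPhysics.QuantumFieldTheory.WilsonOddRP.IsOPosEdge]
    left
    have hval := val_cast_of_nonneg_of_lt (L := L) (a := -e.1 0 + n) (by omega) (by omega)
    constructor
    · have : (1 : ℤ) ≤ ((Literature.MathematicalPhysics.QuantumFieldTheory.Site.timeReflect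
          (Literature.MathematicalPhysics.QuantumFieldTheory.Site.shift
            (Torus.proj L e.1 - Pi.single 0 (n : ZMod L)) 0) 0).val : ℤ) := by
        rw [htm, hval]; omega
      exact_mod_cast this
    · have : ((Literature.MathematicalPhysics.QuantumFieldTheory.Site.timeReflect
          (Literature.MathematicalPhysics.QuantumFieldTheory.Site.shift
            (Torus.proj L e.1 - Pi.single 0 (n : ZMod L)) 0) 0).val : ℤ) ≤ n := by
        rw [htm, hval]; omega
      exact_mod_cast this
  · rw [if_neg hk, if_neg hk]
    refine hUV _ ?_
    rw [Finset.coe_union, Set.mem_union, Finset.mem_coe, Finset.mem_coe,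
      Literature.MathematicalPhysics.QuantumFieldTheory.WilsonOddRP.mem_oPosEdges,
      Literature.MathematicalPhysics.QuantumFieldTheory.WilsonOddRP.IsOPosEdge,
      Literature.MathematicalPhysics.QuantumFieldTheory.WilsonOddRP.mem_oSharedEdges,
      Literature.MathematicalPhysics.QuantumFieldTheory.WilsonOddRP.IsOSharedEdge]
    have hval := val_cast_of_nonneg_of_lt (L := L) (a := 1 - e.1 0 + n) (by omega) (by omega)
    have hvz : ((Literature.MathematicalPhysics.QuantumFieldTheory.Site.timeReflect
        (Torus.proj L e.1 - Pi.single 0 (n : ZMod L)) 0).val : ℤ) = 1 - e.1 0 + n := by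
      rw [hsp, hval]
    by_cases hx0 : e.1 0 = 0
    · right
      refine ⟨hk, ?_⟩
      have : ((Literature.MathematicalPhysics.QuantumFieldTheory.Site.timeReflect
          (Torus.proj L e.1 - Pi.single 0 (n : ZMod L)) 0).val : ℤ) = (n + 1 : ℕ) := by
        rw [hvz, hx0]; push_cast; ring
      exact_mod_cast this
    · left
      constructor
      · have : (1 : ℤ) ≤ ((Literature.MathematicalPhysics.QuantumFieldTheory.Site.timeReflect
            (Torus.proj L e.1 - Pi.single 0 (n : ZMod L)) 0).val : ℤ) := by
          rw [hvz]; omega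
        exact_mod_cast this
      · have : ((Literature.MathematicalPhysics.QuantumFieldTheory.Site.timeReflect
            (Torus.proj L e.1 - Pi.single 0 (n : ZMod L)) 0).val : ℤ) ≤ n := by
          rw [hvz]; omega
        exact_mod_cast this

end Support

end Summit.QuantumFields.GaugeBoot
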